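import Literature.AlgebraicGeometry.Deformation.SmallIdealFlatCoordinates
import Mathlib.RingTheory.Derivation.Basic
import Mathlib.LinearAlgebra.Isomorphisms
import HarnessLib

/-!
# Derivations with values in a module killed by `J` factor through the reduction modulo `J`
# ([SGA1] Exp. III §5 Prop. 5.1: the coefficient sheaf `𝒢 = 𝓗om(g₀^*Ω¹_{X/S}, 𝒥)` lives on the CLOSED subscheme)

Layer `Literature/AlgebraicGeometry/Deformation`, namespace `Literature.AlgebraicGeometry.Deformation`.  THEOREMS ONLY (no
definition, no named fact, no instance, no notation, no `sorry`).  Cell hodgecm-mathlib (D-0151): brick C2 of the (E)-half of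
[MumfordFogartyKirwan1994] Prop. 6.15 (F-11 (A4b) ∕ F-4 II-a-E; sockets B-p01 (g16) `SOCKETS-A4b-FileA-E.v0` §2 C2; hand B-p04 (g22)).
HC_CM is proved only modulo the 7 printed citations until rung 0 closes; nothing here bears on a summit statement.

In [SGA1, Exp. III §5, Prop. 5.1 and Cor. 5.2] the differences of local extensions of `g₀ : Y₀ → X` across a square-zero
thickening `Y₀ ↪ Y` (ideal `𝒥`) are derivations `Der_{𝒪_S}(𝒪_X, 𝒥)`, and «`𝒥` étant annulé par lui-même» they are sections of
`𝒢 = 𝓗om_{𝒪_{Y₀}}(g₀^*Ω¹_{X/S}, 𝒥)` — a sheaf on the CLOSED subscheme: a derivation with values in a module killed by the ideal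
only sees the reduction.  For the product situation of [MumfordFogartyKirwan1994, Prop. 6.15] (`X₀ = X ×_A (A⧸J)`, coefficients
`J·𝒪`) this file records, def-free:

* §1 RING FORM.  `q : R → R₀` a surjective `A`-algebra map whose kernel is generated by the image of an ideal `J ⊆ A` that maps to
  `0` in `R₀`, `M` an `R₀`-module (with the induced `R`-action): every `A`-derivation `D : R → M` FACTORS UNIQUELY through `q`
  (`Derivation.existsUnique_comp_eq_of_ker_le`: `∃! D₀ : Der_A(R₀, M), D₀ ∘ q = D`); and an `A`-derivation of `R₀` is an
  `A₀`-derivation for any quotient `A ↠ A₀` through which the structure map factors (`Derivation.existsUnique_of_surjective_algebraMap`).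
* §2 SCHEME FORM of the hypotheses for a cartesian square `G : X₀ = X ×_A Spec (A⧸J) → X` and an affine open `V ⊆ X`:
  `G⁻¹V` is affine, `G^♯_V : Γ(X, V) → Γ(X₀, G⁻¹V)` is surjective with kernel `J·Γ(X, V)` (★ `ker_app_eq_map_of_isPullback`), and
  `G^♯_V` intertwines the structure maps `A → Γ(X, V)`, `A⧸J → Γ(X₀, G⁻¹V)` (`app_specStructureMap_of_isPullback`).

## References
* [SGA1] A. Grothendieck, M. Raynaud, *Revêtements étales et groupe fondamental (SGA 1)*, LNM 224 ∕ arXiv:math/0206203, Exp. III §5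
  Prop. 5.1 and Cor. 5.2 (arXiv ed. pp. 70–71).
* [MumfordFogartyKirwan1994] D. Mumford, J. Fogarty, F. Kirwan, *Geometric Invariant Theory*, 3rd ed. (1994), Ch. 6 §3 Prop. 6.15,
  proof (pp. 124–125: «`μ̄^*𝒯 ⊗ I`»).
* [Hartshorne2010] R. Hartshorne, *Deformation Theory*, GTM 257 (2010), §6 proof of Thm. 6.4 (p. 50).
-/

noncomputable section

universe u

open CategoryTheory AlgebraicGeometry Opposite IsLocalRing

namespace Literature.AlgebraicGeometry.Deformation

/-! ### §1 Ring form: derivations into a module killed by `J` factor through `R ↠ R ⧸ J·R` -/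

section Ring

variable {A R R₀ M : Type*} [CommRing A] [CommRing R] [CommRing R₀] [Algebra A R] [Algebra A R₀]
  [AddCommGroup M] [Module A M] [Module R M] [Module R₀ M] [IsScalarTower A R M] [IsScalarTower A R₀ M]
  (q : R →ₐ[A] R₀) (hq : Function.Surjective q)

omit [IsScalarTower A R M] [IsScalarTower A R₀ M] in
/-- An `A`-derivation `D : R → M` kills the ideal generated by the image of `J ⊆ A` as soon as `J` kills `M` (through `R₀`):
`D(∑ rᵢ jᵢ) = ∑ jᵢ · D rᵢ = 0`. [cite: SGA1, Exp. III §5 Prop. 5.1 (coefficient sheaf on `Y₀`)] -/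
theorem derivation_eq_zero_of_mem_map (hcompat : ∀ (r : R) (m : M), r • m = q r • m) {J : Ideal A}
    (hJ : ∀ j ∈ J, algebraMap A R₀ j = 0) (D : Derivation A R M) {x : R} (hx : x ∈ J.map (algebraMap A R)) : D x = 0 := by
  rw [Ideal.map] at hx
  refine Submodule.span_induction (p := fun x _ => D x = 0) ?_ ?_ ?_ ?_ hx
  · rintro x ⟨j, hj, rfl⟩
    exact D.map_algebraMap j
  · exact D.map_zero
  · intro x y _ _ hx hy
    rw [D.map_add, hx, hy, add_zero]
  · intro a x hxJ hx
    rw [smul_eq_mul, D.leibniz, hx, smul_zero, zero_add]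
    -- `x • D a = q x • D a = 0` since `q x ∈ J·R₀ = 0`
    rw [hcompat]
    have hqx : q x = 0 := by
      refine Submodule.span_induction (p := fun x _ => q x = 0) ?_ ?_ ?_ ?_ hxJ
      · rintro y ⟨j, hj, rfl⟩
        rw [AlgHom.commutes]; exact hJ j hj
      · exact map_zero q
      · intro y z _ _ hy hz
        rw [map_add, hy, hz, add_zero]
      · intro b y _ hy
        rw [smul_eq_mul, map_mul, hy, mul_zero]
    rw [hqx, zero_smul]

omit [IsScalarTower A R M] [IsScalarTower A R₀ M] in
include hq in
/-- **Derivations into a module killed by `J` factor UNIQUELY through `q : R ↠ R₀`** when `ker q ⊆ J·R` and `J ↦ 0` in `R₀`: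
`∃! D₀ ∈ Der_A(R₀, M)` with `D₀ (q r) = D r`.  (The differences of local lifts across the thickening defined by `J` are
derivations of the REDUCTION.) [cite: SGA1, Exp. III §5 Prop. 5.1 and Cor. 5.2] [cite: MumfordFogartyKirwan1994, Ch. 6 §3 Proposition 6.15, proof (pp. 124–125)] -/
theorem existsUnique_derivation_comp_eq_of_ker_le (hcompat : ∀ (r : R) (m : M), r • m = q r • m) {J : Ideal A}
    (hJ : ∀ j ∈ J, algebraMap A R₀ j = 0) (hker : RingHom.ker q.toRingHom ≤ J.map (algebraMap A R))
    (D : Derivation A R M) : ∃! D₀ : Derivation A R₀ M, ∀ r, D₀ (q r) = D r := by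
  -- the underlying `A`-linear map factors through the surjection `q`
  have hle : LinearMap.ker q.toLinearMap ≤ LinearMap.ker D.toLinearMap := fun x hx =>
    derivation_eq_zero_of_mem_map q hcompat hJ D (hker (by simpa using hx))
  let f₀ : R₀ →ₗ[A] M :=
    ((LinearMap.ker q.toLinearMap).liftQ D.toLinearMap hle).comp (q.toLinearMap.quotKerEquivOfSurjective hq).symm.toLinearMap
  have hf₀ : ∀ r, f₀ (q r) = D r := fun r => by
    change ((LinearMap.ker q.toLinearMap).liftQ D.toLinearMap hle)
      ((q.toLinearMap.quotKerEquivOfSurjective hq).symm (q.toLinearMap r)) = D r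
    rw [LinearMap.quotKerEquivOfSurjective_symm_apply]
    rfl
  refine ⟨{ toLinearMap := f₀, map_one_eq_zero' := ?_, leibniz' := ?_ }, fun r => hf₀ r, ?_⟩
  · rw [← map_one q, hf₀, D.map_one_eq_zero]
  · intro x y
    obtain ⟨a, rfl⟩ := hq x
    obtain ⟨b, rfl⟩ := hq y
    rw [← map_mul, hf₀, hf₀, hf₀, D.leibniz, hcompat, hcompat]
  · intro D₁ hD₁
    ext x
    obtain ⟨a, rfl⟩ := hq x
    rw [hD₁ a]
    exact (hf₀ a).symm

omit [IsScalarTower A R₀ M] in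
/-- **An `A`-derivation of `R₀` is an `A₀`-derivation** for a quotient `A ↠ A₀` through which the structure map of `R₀` factors
(`A`-linearity is `A₀`-linearity). [cite: SGA1, Exp. III §5 Prop. 5.1 (`Der_{𝒪_S}` versus `Der_{𝒪_{S₀}}`)] -/
theorem existsUnique_derivation_of_surjective_algebraMap {A₀ : Type*} [CommRing A₀] [Algebra A A₀] [Algebra A₀ R₀]
    [IsScalarTower A A₀ R₀] [Module A₀ M] [IsScalarTower A A₀ M] [IsScalarTower A₀ R₀ M]
    (hA : Function.Surjective (algebraMap A A₀)) (D : Derivation A R₀ M) :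
    ∃! D' : Derivation A₀ R₀ M, ∀ r, D' r = D r := by
  have hsmul : ∀ (a₀ : A₀) (r : R₀), D (a₀ • r) = a₀ • D r := fun a₀ r => by
    obtain ⟨a, rfl⟩ := hA a₀
    rw [algebraMap_smul, algebraMap_smul]
    exact D.map_smul a r
  let L : R₀ →ₗ[A₀] M := { toFun := D, map_add' := D.map_add, map_smul' := hsmul }
  refine ⟨{ toLinearMap := L, map_one_eq_zero' := D.map_one_eq_zero, leibniz' := D.leibniz }, fun r => rfl,
    fun D₁ hD₁ => Derivation.ext hD₁⟩

end Ring


/-! ### §1b The same in the BARE LEIBNIZ dialect of ★ `HodgeTheory/CoframeDerivationCoordinates` (no `Derivation` structures) -/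

section Bare

variable {R R₀ Cb N : Type*} [CommRing R] [CommRing R₀] [CommRing Cb] [AddCommGroup N] [Module Cb N]

/-- An additive map is a homomorphism of additive groups: it preserves `0`, negation and subtraction.
[cite: SGA1, Exp. III §5 Prop. 5.1] -/
theorem leibniz_map_sub (δ : R → N) (hadd : ∀ a b, δ (a + b) = δ a + δ b) (a b : R) : δ (a - b) = δ a - δ b := by
  have h := (AddMonoidHom.mk' δ hadd).map_sub a b
  simpa using h

/-- **Generator test**: a map `δ` Leibniz along `ψ` that kills a set `T` on which `ψ` also vanishes kills the ideal
generated by `T` (`δ(r·t) = ψ(r)δ(t) + ψ(t)δ(r) = 0`).  For `T` = the image of an ideal `J` of the base this says: `δ` kills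
`J·R` as soon as it kills the constants and the chart reduces `J` to `0`. [cite: SGA1, Exp. III §5 Prop. 5.1 (coefficient sheaf on `Y₀`)] -/
theorem leibniz_eq_zero_of_mem_span (ψ : R →+* Cb) (δ : R → N) (hadd : ∀ a b, δ (a + b) = δ a + δ b)
    (hmul : ∀ a b, δ (a * b) = ψ a • δ b + ψ b • δ a) {T : Set R} (hT : ∀ t ∈ T, δ t = 0 ∧ ψ t = 0) :
    ∀ a ∈ Ideal.span T, δ a = 0 := by
  intro a ha
  have h0 : δ 0 = 0 := by simpa using (AddMonoidHom.mk' δ hadd).map_zero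
  refine Submodule.span_induction (p := fun x _ => δ x = 0) ?_ h0 ?_ ?_ ha
  · exact fun t ht => (hT t ht).1
  · intro x y _ _ hx hy
    rw [hadd, hx, hy, add_zero]
  · intro r x hx hδx
    have hψx : ψ x = 0 := by
      refine Submodule.span_induction (p := fun x _ => ψ x = 0) (fun t ht => (hT t ht).2) (map_zero ψ) ?_ ?_ hx
      · intro y z _ _ hy hz
        rw [map_add, hy, hz, add_zero]
      · intro b y _ hy
        rw [smul_eq_mul, map_mul, hy, mul_zero]
    rw [smul_eq_mul, hmul, hδx, smul_zero, zero_add, hψx, zero_smul]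

/-- **Bare factorisation through a surjection.**  `q : R ↠ R₀`, charts `ψ = ψ₀ ∘ q` into `C̄`, `N` a `C̄`-module, and
`δ : R → N` additive, Leibniz along `ψ`, vanishing on `ker q`: then `δ = δ₀ ∘ q` for a map `δ₀ : R₀ → N` which is additive and
Leibniz along `ψ₀` (the derivation of the REDUCTION).  [cite: SGA1, Exp. III §5 Prop. 5.1 and Cor. 5.2]
[cite: MumfordFogartyKirwan1994, Ch. 6 §3 Proposition 6.15, proof (pp. 124–125)] -/
theorem exists_leibniz_factor_of_surjective (q : R →+* R₀) (hq : Function.Surjective q) (ψ : R →+* Cb) (ψ₀ : R₀ →+* Cb)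
    (hψ : ∀ a, ψ a = ψ₀ (q a)) (δ : R → N) (hadd : ∀ a b, δ (a + b) = δ a + δ b)
    (hmul : ∀ a b, δ (a * b) = ψ a • δ b + ψ b • δ a) (hker : ∀ a ∈ RingHom.ker q, δ a = 0) :
    ∃ δ₀ : R₀ → N, (∀ a, δ a = δ₀ (q a)) ∧ (∀ x y, δ₀ (x + y) = δ₀ x + δ₀ y) ∧
      ∀ x y, δ₀ (x * y) = ψ₀ x • δ₀ y + ψ₀ y • δ₀ x := by
  -- `δ a` only depends on `q a`
  have hwd : ∀ a a', q a = q a' → δ a = δ a' := fun a a' h => by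
    have h1 : δ (a - a') = 0 := hker _ (by rw [RingHom.mem_ker, map_sub, h, sub_self])
    rw [leibniz_map_sub δ hadd] at h1
    exact sub_eq_zero.1 h1
  have hs : ∀ x, q (Function.surjInv hq x) = x := fun x => Function.surjInv_eq hq x
  refine ⟨fun x => δ (Function.surjInv hq x), fun a => hwd _ _ (hs (q a)).symm, fun x y => ?_, fun x y => ?_⟩
  · show δ (Function.surjInv hq (x + y)) = δ (Function.surjInv hq x) + δ (Function.surjInv hq y)
    rw [hwd (Function.surjInv hq (x + y)) (Function.surjInv hq x + Function.surjInv hq y)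
      (by rw [map_add, hs, hs, hs]), hadd]
  · show δ (Function.surjInv hq (x * y)) = ψ₀ x • δ (Function.surjInv hq y) + ψ₀ y • δ (Function.surjInv hq x)
    rw [hwd (Function.surjInv hq (x * y)) (Function.surjInv hq x * Function.surjInv hq y)
      (by rw [map_mul, hs, hs, hs]), hmul, hψ, hψ, hs, hs]

omit [AddCommGroup N] in
/-- Uniqueness of the bare factorisation through a surjection. [cite: SGA1, Exp. III §5 Prop. 5.1] -/
theorem leibniz_factor_unique (q : R →+* R₀) (hq : Function.Surjective q) {δ₀ δ₀' : R₀ → N}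
    (h : ∀ a, δ₀ (q a) = δ₀' (q a)) : δ₀ = δ₀' := by
  funext x
  obtain ⟨a, rfl⟩ := hq x
  exact h a

/-- **Constants**: if `δ = δ₀ ∘ q` kills the `S`-constants of `R` and the structure maps commute with `q` along a surjection
`φ : S ↠ S₀`, then `δ₀` kills the `S₀`-constants of `R₀`. [cite: SGA1, Exp. III §5 Prop. 5.1 (`Der_{𝒪_S}`)] -/
theorem leibniz_factor_const_eq_zero {S S₀ : Type*} [CommRing S] [CommRing S₀] (q : R →+* R₀) (σ : S →+* R)
    (σ₀ : S₀ →+* R₀) (φ : S →+* S₀) (hφ : Function.Surjective φ) (hcomm : ∀ s, q (σ s) = σ₀ (φ s))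
    {δ : R → N} {δ₀ : R₀ → N} (hδ : ∀ a, δ a = δ₀ (q a)) (hconst : ∀ s, δ (σ s) = 0) (s₀ : S₀) :
    δ₀ (σ₀ s₀) = 0 := by
  obtain ⟨s, rfl⟩ := hφ s₀
  rw [← hcomm, ← hδ, hconst]

end Bare

/-! ### §1c The `J`-REDUCTION of a Leibniz map with values in `J·C` (the step between O5's chart derivations and the coframe coordinates) -/

section JReduction

variable {A C Cb R : Type*} [CommRing A] [IsLocalRing A] [CommRing C] [Algebra A C] [CommRing Cb] [CommRing R]
  {r : ℕ} (j : Fin r → A) {J : Ideal A}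

/-- **`J`-reduction of a Leibniz map** ([SGA1] III 5.1 coefficients «`𝒥 ≅ J ⊗_k 𝒪_{Y₀}`» for `𝔪·J = 0` over a flat `Y`;
[Hartshorne2010] §6 «`J ⊗_C A' = J ⊗_k A₀`»).  `A` local, `J ≤ 𝔪` with `𝔪·J = 0` and generators `j_ρ` independent modulo
`𝔪` (★ `exists_generators_independent_mod_maximalIdeal`); `C` a FLAT `A`-algebra with reduction `θ : C ↠ C̄`,
`ker θ = 𝔪·C`; `ψ : R → C` a chart compatible with the structure maps (`ψ ∘ s_R = algebraMap`); `δ : R → C` additive, Leibniz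
along `ψ`, killing the constants, with values in `J·C`.  Then the COORDINATES of `δ` modulo `𝔪` form a map
`Δ : R → C̄^r`, additive, Leibniz along `θ ∘ ψ`, killing the constants AND the ideal `J·R` (so it factors through `R ↠ R⧸J·R`,
`exists_leibniz_factor_of_surjective`), characterised by `δ a = ∑ j_ρ d_ρ ⇒ Δ a = θ ∘ d`, and recovering `δ` through any
set-theoretic section `ℓ` of `θ`: `δ a = ∑ j_ρ ℓ(Δ a ρ)`. [cite: SGA1, Exp. III §5 Prop. 5.1] [cite: Hartshorne2010, §6 proof of Thm. 6.2 (p. 46) and Thm. 6.4 (p. 50)] -/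
theorem exists_jReduction [Module.Flat A C] (hj : ∀ ρ, j ρ ∈ J) (hspan : J ≤ Ideal.span (Set.range j))
    (hind : ∀ a : Fin r → A, ∑ ρ, a ρ * j ρ = 0 → ∀ ρ, a ρ ∈ maximalIdeal A)
    (hmJ : maximalIdeal A * J = ⊥) (hJle : J ≤ maximalIdeal A)
    (θ : C →+* Cb) (hkerθ : RingHom.ker θ = (maximalIdeal A).map (algebraMap A C))
    (sR : A →+* R) (ψ : R →+* C) (hψ : ∀ x, ψ (sR x) = algebraMap A C x)
    (δ : R → C) (hadd : ∀ a b, δ (a + b) = δ a + δ b) (hmul : ∀ a b, δ (a * b) = ψ a * δ b + ψ b * δ a)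
    (hconst : ∀ x, δ (sR x) = 0) (hδJ : ∀ a, δ a ∈ J.map (algebraMap A C)) :
    ∃ Δ : R → (Fin r → Cb),
      (∀ a b, Δ (a + b) = Δ a + Δ b) ∧ (∀ a b, Δ (a * b) = θ (ψ a) • Δ b + θ (ψ b) • Δ a) ∧ (∀ x, Δ (sR x) = 0) ∧
      (∀ a (d : Fin r → C), δ a = ∑ ρ, algebraMap A C (j ρ) * d ρ → ∀ ρ, Δ a ρ = θ (d ρ)) ∧
      (∀ a (ℓ : Cb → C), (∀ x, θ (ℓ x) = x) → δ a = ∑ ρ, algebraMap A C (j ρ) * ℓ (Δ a ρ)) ∧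
      (∀ a ∈ J.map sR, Δ a = 0) := by
  classical
  -- coordinates of `δ a` in `J·C`
  choose d hd using fun a => exists_eq_sum_mul_of_mem_map j hspan (hδJ a)
  have hθeq : ∀ x y : C, x - y ∈ (maximalIdeal A).map (algebraMap A C) → θ x = θ y := fun x y h => by
    rw [← hkerθ, RingHom.mem_ker, map_sub, sub_eq_zero] at h; exact h
  -- CHARACTERISATION: any coordinate vector of `δ a` reduces to `Δ a`
  have hchar : ∀ a (d' : Fin r → C), δ a = ∑ ρ, algebraMap A C (j ρ) * d' ρ → ∀ ρ, θ (d a ρ) = θ (d' ρ) :=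
    fun a d' h ρ => hθeq _ _ (sub_mem_map_maximalIdeal_of_sum_mul_eq j hind ((hd a).symm.trans h) ρ)
  refine ⟨fun a ρ => θ (d a ρ), fun a b => ?_, fun a b => ?_, fun x => ?_, fun a d' h ρ => hchar a d' h ρ,
    fun a ℓ hℓ => ?_, ?_⟩
  · -- additivity: `d a + d b` are coordinates of `δ (a + b)`
    funext ρ
    have h : δ (a + b) = ∑ ρ, algebraMap A C (j ρ) * (d a ρ + d b ρ) := by
      rw [hadd, hd a, hd b, ← Finset.sum_add_distrib]
      exact Finset.sum_congr rfl fun ρ _ => (mul_add _ _ _).symm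
    show θ (d (a + b) ρ) = θ (d a ρ) + θ (d b ρ)
    rw [hchar _ _ h ρ, map_add]
  · -- Leibniz: `ψ a · d b + ψ b · d a` are coordinates of `δ (a * b)`
    funext ρ
    have h : δ (a * b) = ∑ ρ, algebraMap A C (j ρ) * (ψ a * d b ρ + ψ b * d a ρ) := by
      rw [hmul, hd a, hd b, Finset.mul_sum, Finset.mul_sum, ← Finset.sum_add_distrib]
      exact Finset.sum_congr rfl fun ρ _ => by ring
    show θ (d (a * b) ρ) = (θ (ψ a) • (fun ρ => θ (d b ρ)) + θ (ψ b) • (fun ρ => θ (d a ρ))) ρ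
    rw [hchar _ _ h ρ, Pi.add_apply, Pi.smul_apply, Pi.smul_apply, smul_eq_mul, smul_eq_mul, map_add, map_mul,
      map_mul]
  · -- constants: `0` are coordinates of `δ (s_R x) = 0`
    funext ρ
    have h : δ (sR x) = ∑ ρ, algebraMap A C (j ρ) * (0 : Fin r → C) ρ := by
      rw [hconst]; exact (Finset.sum_eq_zero fun ρ _ => by simp).symm
    show θ (d (sR x) ρ) = 0
    rw [hchar _ _ h ρ, Pi.zero_apply, map_zero]
  · -- recovering `δ` through a section `ℓ` of `θ`
    rw [hd a]
    exact sum_mul_eq_sum_mul_of_sub_mem j hj hmJ fun ρ => by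
      rw [← hkerθ, RingHom.mem_ker, map_sub, hℓ, sub_self]
  · -- `Δ` kills `J·R`: generator test, `θ (ψ (s_R j)) = θ (j) = 0` since `J ≤ 𝔪`
    have hT : ∀ t ∈ sR '' (J : Set A), (fun a ρ => θ (d a ρ)) t = 0 ∧ (θ.comp ψ) t = 0 := by
      rintro t ⟨x, hx, rfl⟩
      refine ⟨?_, ?_⟩
      · funext ρ
        have h : δ (sR x) = ∑ ρ, algebraMap A C (j ρ) * (0 : Fin r → C) ρ := by
          rw [hconst]; exact (Finset.sum_eq_zero fun ρ _ => by simp).symm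
        show θ (d (sR x) ρ) = 0
        rw [hchar _ _ h ρ, Pi.zero_apply, map_zero]
      · rw [RingHom.comp_apply, hψ, ← RingHom.mem_ker, hkerθ]
        exact Ideal.mem_map_of_mem _ (hJle hx)
    have hΔmul : ∀ a b, (fun a ρ => θ (d a ρ)) (a * b) =
        (θ.comp ψ) a • (fun a ρ => θ (d a ρ)) b + (θ.comp ψ) b • (fun a ρ => θ (d a ρ)) a := fun a b => by
      funext ρ
      have h : δ (a * b) = ∑ ρ, algebraMap A C (j ρ) * (ψ a * d b ρ + ψ b * d a ρ) := by
        rw [hmul, hd a, hd b, Finset.mul_sum, Finset.mul_sum, ← Finset.sum_add_distrib]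
        exact Finset.sum_congr rfl fun ρ _ => by ring
      show θ (d (a * b) ρ) = (θ (ψ a) • (fun ρ => θ (d b ρ)) + θ (ψ b) • (fun ρ => θ (d a ρ))) ρ
      rw [hchar _ _ h ρ, Pi.add_apply, Pi.smul_apply, Pi.smul_apply, smul_eq_mul, smul_eq_mul, map_add, map_mul,
        map_mul]
    have hΔadd : ∀ a b, (fun a ρ => θ (d a ρ)) (a + b) = (fun a ρ => θ (d a ρ)) a + (fun a ρ => θ (d a ρ)) b :=
      fun a b => by
      funext ρ
      have h : δ (a + b) = ∑ ρ, algebraMap A C (j ρ) * (d a ρ + d b ρ) := by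
        rw [hadd, hd a, hd b, ← Finset.sum_add_distrib]
        exact Finset.sum_congr rfl fun ρ _ => (mul_add _ _ _).symm
      show θ (d (a + b) ρ) = θ (d a ρ) + θ (d b ρ)
      rw [hchar _ _ h ρ, map_add]
    intro a ha
    exact leibniz_eq_zero_of_mem_span (θ.comp ψ) _ hΔadd hΔmul hT a ha

end JReduction

/-! ### §2 Scheme form of the hypotheses for `G : X ×_A Spec (A⧸J) → X` on an affine open -/

section Scheme

variable {A : Type u} [CommRing A] (J : Ideal A) {X X₀ : Scheme.{u}} {q : X ⟶ Spec (.of A)}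
  {q₀ : X₀ ⟶ Spec (.of (A ⧸ J))} {G : X₀ ⟶ X}
  (hG : IsPullback G q₀ q (Spec.map (CommRingCat.ofHom (Ideal.Quotient.mk J))))

/-- The structure map of a composite with `Spec` of a ring map: `A → Γ(X₀, ⊤)` of `q₀ ≫ Spec φ` is `(A₀ → Γ(X₀, ⊤)) ∘ φ`.
[cite: Hartshorne2010, §6 proof of Thm. 6.4 (p. 50)] -/
theorem specStructureMap_comp_specMap {A₀ : Type u} [CommRing A₀] (φ : A →+* A₀) (q₀ : X₀ ⟶ Spec (.of A₀)) :
    specStructureMap (q₀ ≫ Spec.map (CommRingCat.ofHom φ)) = (specStructureMap q₀).comp φ := by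
  ext a
  change ((Scheme.ΓSpecIso (.of A)).inv ≫ (q₀ ≫ Spec.map (CommRingCat.ofHom φ)).appTop).hom a =
    ((Scheme.ΓSpecIso (.of A₀)).inv ≫ q₀.appTop).hom (φ a)
  rw [Scheme.Hom.comp_appTop, ← Category.assoc, ← Scheme.ΓSpecIso_inv_naturality]
  rfl

include hG in
/-- `G⁻¹V` is affine for `V ⊆ X` affine (`G` is a closed immersion, a base change of `Spec (A⧸J) ↪ Spec A`).
[cite: Hartshorne2010, §6 proof of Thm. 6.4 (p. 50)] -/
theorem isAffineOpen_preimage_of_isPullback_mk (V : X.affineOpens) : IsAffineOpen (G ⁻¹ᵁ V.1) := by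
  haveI : IsClosedImmersion G :=
    MorphismProperty.of_isPullback hG.flip (IsClosedImmersion.spec_of_surjective _ Ideal.Quotient.mk_surjective)
  exact V.2.preimage G

include hG in
/-- **`Γ(X₀, G⁻¹V) = Γ(X, V) ⧸ J·Γ(X, V)`**: `G^♯_V` is surjective with kernel `J·Γ(X, V)` (★ `ker_app_eq_map_of_isPullback`;
Mathlib `Scheme.Hom.app_surjective`). [cite: Hartshorne2010, §6 proof of Thm. 6.4 (p. 50)] -/
theorem app_surjective_and_ker_eq_of_isPullback_mk (V : X.affineOpens) :
    Function.Surjective (G.app V.1) ∧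
      RingHom.ker (G.app V.1).hom = J.map ((X.presheaf.map (homOfLE (le_top : V.1 ≤ ⊤)).op).hom.comp (specStructureMap q)) := by
  haveI : IsClosedImmersion G :=
    MorphismProperty.of_isPullback hG.flip (IsClosedImmersion.spec_of_surjective _ Ideal.Quotient.mk_surjective)
  refine ⟨G.app_surjective V.1 V.2, ?_⟩
  have h := ker_app_eq_map_of_isPullback (Ideal.Quotient.mk J) Ideal.Quotient.mk_surjective hG V
  rwa [Ideal.mk_ker] at h

include hG in
/-- **`G^♯` intertwines the structure maps**: `G^♯_V (a|_V) = (ā)|_{G⁻¹V}` for `a ∈ A`, `ā` its class in `A⧸J` — so `G^♯_V` is an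
`A`-algebra map for the structure maps, and `J ↦ 0` downstairs. [cite: Hartshorne2010, §6 proof of Thm. 6.4 (p. 50)] -/
theorem app_specStructureMap_of_isPullback_mk (V : X.Opens) (a : A) :
    G.app V (X.presheaf.map (homOfLE (le_top : V ≤ ⊤)).op (specStructureMap q a)) =
      X₀.presheaf.map (homOfLE (le_top : G ⁻¹ᵁ V ≤ ⊤)).op (specStructureMap q₀ (Ideal.Quotient.mk J a)) := by
  have h1 : G.app V (X.presheaf.map (homOfLE (le_top : V ≤ ⊤)).op (specStructureMap q a)) =
      X₀.presheaf.map (homOfLE (le_top : G ⁻¹ᵁ V ≤ ⊤)).op (G.appTop (specStructureMap q a)) := by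
    rw [← CommRingCat.comp_apply, G.naturality]
    rfl
  have h2 : G.appTop (specStructureMap q a) = specStructureMap (G ≫ q) a := by
    rw [specStructureMap_comp]; rfl
  rw [h1, h2, hG.w, specStructureMap_comp_specMap]
  rfl

end Scheme

/-! ### §3 Scheme reading for ANY surjection `φ : A ↠ A'` (both `G` (`φ = mk J`) and the closed fibre (`φ = residue`)) -/

section General

variable {A A' : Type u} [CommRing A] [CommRing A'] (φ : A →+* A') (hφ : Function.Surjective φ) {Y Z : Scheme.{u}}
  {q : Y ⟶ Spec (.of A)} {q' : Z ⟶ Spec (.of A')} {i : Z ⟶ Y}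

include hφ in
/-- **`Γ(Z, i⁻¹U) = Γ(Y, U) ⧸ ker(φ)·Γ(Y, U)`** for the base change `i : Z = Y ×_A Spec A' → Y` of `Spec` of a SURJECTION
`φ : A ↠ A'` and an affine open `U ⊆ Y`: `i^♯_U` is surjective with kernel `ker(φ)·Γ(Y, U)` (★ `ker_app_eq_map_of_isPullback`;
Mathlib `Scheme.Hom.app_surjective`). [cite: Hartshorne2010, §6 proof of Thm. 6.4 (p. 50)] -/
theorem app_surjective_and_ker_eq_of_isPullback (H : IsPullback i q' q (Spec.map (CommRingCat.ofHom φ)))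
    (U : Y.affineOpens) :
    Function.Surjective (i.app U.1) ∧
      RingHom.ker (i.app U.1).hom =
        (RingHom.ker φ).map ((Y.presheaf.map (homOfLE (le_top : U.1 ≤ ⊤)).op).hom.comp (specStructureMap q)) := by
  haveI : IsClosedImmersion i := MorphismProperty.of_isPullback H.flip (IsClosedImmersion.spec_of_surjective _ hφ)
  exact ⟨i.app_surjective U.1 U.2, ker_app_eq_map_of_isPullback φ hφ H U⟩

include hφ in
/-- `i⁻¹U` is affine for `U` affine (`i` is a closed immersion). [cite: Hartshorne2010, §6 proof of Thm. 6.4 (p. 50)] -/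
theorem isAffineOpen_preimage_of_isPullback (H : IsPullback i q' q (Spec.map (CommRingCat.ofHom φ)))
    (U : Y.affineOpens) : IsAffineOpen (i ⁻¹ᵁ U.1) := by
  haveI : IsClosedImmersion i := MorphismProperty.of_isPullback H.flip (IsClosedImmersion.spec_of_surjective _ hφ)
  exact U.2.preimage i

/-- `i^♯` intertwines the structure maps: `i^♯_U (a|_U) = (φ a)|_{i⁻¹U}`. [cite: Hartshorne2010, §6 proof of Thm. 6.4 (p. 50)] -/
theorem app_specStructureMap_of_isPullback (H : IsPullback i q' q (Spec.map (CommRingCat.ofHom φ))) (U : Y.Opens)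
    (a : A) :
    i.app U (Y.presheaf.map (homOfLE (le_top : U ≤ ⊤)).op (specStructureMap q a)) =
      Z.presheaf.map (homOfLE (le_top : i ⁻¹ᵁ U ≤ ⊤)).op (specStructureMap q' (φ a)) := by
  have h1 : i.app U (Y.presheaf.map (homOfLE (le_top : U ≤ ⊤)).op (specStructureMap q a)) =
      Z.presheaf.map (homOfLE (le_top : i ⁻¹ᵁ U ≤ ⊤)).op (i.appTop (specStructureMap q a)) := by
    rw [← CommRingCat.comp_apply, i.naturality]
    rfl
  have h2 : i.appTop (specStructureMap q a) = specStructureMap (i ≫ q) a := by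
    rw [specStructureMap_comp]; rfl
  rw [h1, h2, H.w, specStructureMap_comp_specMap]
  rfl

end General

end Literature.AlgebraicGeometry.Deformation

end
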